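import Literature.Analysis.FluidPDE.PassiveScalarDiagForcedSteadyTest
import Literature.Analysis.FluidPDE.TransportWeakExistenceProofs
import HarnessLib

/-!
# The `L²` trace and the weakly continuous representative of a weak diagonal-diffusion
# passive scalar with a source

Analysis/FluidPDE proof-support file (everything proved). For a weak solution `θ` of
`∂ₜθ + u·∇θ = κ ∑ᵢ aᵢ ∂ᵢ∂ᵢθ + s` on `T^d × [0,T)`, `T > 0`, with datum `θ₀`
(`Torus.IsWeakScalarTransportDiagForcedOn T a κ u s θ₀ θ`; weak solutions are determined for a.e.
`t` only, `θ ∈ L^∞_t L²_x`), the **trace** of `θ` at a time `σ ∈ [0,T]` against a smooth steady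
field `g` is the value at `σ` of the absolutely continuous representative of `t ↦ ∫ θ(t) g`
(`PassiveScalarDiagForcedSteadyTest`),

  `P_g(σ) = ∫ θ₀ g + ∫_{(0,σ]} ( ∫ θ(τ) (⟪u(τ), ∇g⟫ + κ ∑ᵢ aᵢ ∂ᵢ∂ᵢ g) + ∫ s(τ) g ) dτ`.

* `IsWeakScalarTransportDiagForcedOn.exists_weaklyContinuous_representative` — there is a field
  `w`, jointly measurable, with `w(t) ∈ L²`, `∫ w(t)² ≤ C` for every `t`, `w(t) = θ(t)` a.e. for
  a.e. `t ∈ (0,T)`, `t ↦ ∫ w(t) g` continuous on `[0,T]` for every `g ∈ L²`, and the TRACE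
  IDENTITIES `∫ w(σ) g = P_g(σ)` for every smooth `g` and EVERY `σ ∈ [0,T]` (the `C([0,T]; L²_w)`
  representative; De Lellis–Székelyhidi 2010, Lemma 7.1 / Appendix A, for the transport–diffusion
  class of DiPerna–Lions 1989, §II.1): the real and imaginary parts of the Fourier coefficients of
  `w(t)` are the absolutely continuous representatives of the pairings of `θ` with the cosine and
  sine modes (`ae_integral_mul_eq`), realised by the parametrised Riesz–Fischer theorem
  (`exists_realScalarField_forall_mFourierCoeff_eq`), exactly as
  `IsWeakScalarTransportOn.exists_continuous_coeff` (`TransportWeakExistenceProofs`, isotropic,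
  unforced, energy-bounded) — here for the diagonal class with a source and the class's own
  `L^∞_t L²_x` bound;
* `ae_eq_of_forall_integral_mul_smooth_eq` — two integrable functions with the same pairings
  against all smooth fields agree a.e.; hence the trace at `σ` is unique
  (`IsWeakScalarTransportDiagForcedOn.trace_unique`) and `w(0) = θ₀` a.e. for an integrable datum
  (`….representative_zero_ae_eq`).

The restart property (`PassiveScalarDiagForcedRestart`) starts the translated solution
`t ↦ θ(σ + t)` from any datum satisfying the trace identities at `σ`, e.g. `w(σ)`.

## Mathlib / tree search

Tree (reused): `continuousOn_integral_mul_of_coeff`, `ae_eq_of_forall_mFourierCoeff_ofReal_eq`,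
`exists_realScalarField_forall_mFourierCoeff_eq` (`TransportWeakExistenceProofs`),
`re_mFourierCoeff_ofReal`, `im_mFourierCoeff_ofReal`, `hasSum_sq_norm_mFourierCoeff_ofReal`,
`isConjSymmScalar_mFourierCoeff`, `isSmooth_reTrigPoly` (`TorusScalarTrigPoly`),
`lintegral_enorm_sq_eq_ofReal_sq` (`TransportGalerkinExistence`); Mathlib
`Measure.eqOn_Icc_of_ae_eq`, `intervalIntegral.continuousOn_primitive`.

## References

* R. J. DiPerna, P.-L. Lions, Invent. Math. 98 (1989), §II.1, (13)–(14). [`DiPernaLions1989`]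
* C. De Lellis, L. Székelyhidi Jr., Arch. Ration. Mech. Anal. 195 (2010), Lemma 7.1, App. A.
  [`DeLellisSzekelyhidi2010`]
* J. C. Robinson, J. L. Rodrigo, W. Sadowski, *The Three-Dimensional Navier–Stokes Equations*
  (CUP 2016), Thm. 4.11. [`RobinsonRodrigoSadowski2016`]
* L. Grafakos, *Classical Fourier Analysis*, 3rd ed. (2014), Prop. 3.2.4. [`Grafakos2014`]
-/

noncomputable section

open _root_.MeasureTheory _root_.Set _root_.Filter _root_.Function _root_.TopologicalSpace _root_.UnitAddTorus
open scoped ENNReal NNReal InnerProductSpace ContDiff ComplexConjugate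

namespace Literature.Analysis.FluidPDE

namespace Torus

open Literature.Analysis.FunctionSpaces.Torus Literature.Analysis.FunctionSpaces

variable {d : Type*} [Fintype d] [DecidableEq d]

/-! ## Tools: a.e. versus everywhere on `[0,T]`, Parseval, pairings against smooth fields -/

section Tools

omit [Fintype d] [DecidableEq d] in
/-- Two functions continuous on `[0,T]` that agree for a.e. `t ∈ (0,T)` agree on `[0,T]`
(`T > 0`). [folklore] -/
private theorem eqOn_Icc_of_ae_restrict_Ioo {Y : Type*} [TopologicalSpace Y] [T2Space Y] {T : ℝ}
    (hT : 0 < T) {f g : ℝ → Y} (hf : ContinuousOn f (Icc 0 T)) (hg : ContinuousOn g (Icc 0 T))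
    (h : ∀ᵐ t ∂(volume.restrict (Ioo 0 T)), f t = g t) : EqOn f g (Icc 0 T) := by
  refine Measure.eqOn_Icc_of_ae_eq (μ := volume) hT.ne ?_ hf hg
  have e : (volume : Measure ℝ).restrict (Icc 0 T) = volume.restrict (Ioo 0 T) :=
    Measure.restrict_congr_set Ioo_ae_eq_Icc.symm
  rw [e]
  exact h

omit [Fintype d] [DecidableEq d] in
/-- A function continuous on `[0,T]` which is `≤ M` for a.e. `t ∈ (0,T)` is `≤ M` on `[0,T]`
(`T > 0`). [folklore] -/
private theorem le_on_Icc_of_ae_restrict_Ioo {T : ℝ} (hT : 0 < T) {f : ℝ → ℝ} {M : ℝ}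
    (hf : ContinuousOn f (Icc 0 T)) (h : ∀ᵐ t ∂(volume.restrict (Ioo 0 T)), f t ≤ M) :
    ∀ t ∈ Icc 0 T, f t ≤ M := by
  have key := eqOn_Icc_of_ae_restrict_Ioo (Y := ℝ) hT (hf.sup continuousOn_const) continuousOn_const
    (f := fun t => max (f t) M) (g := fun _ => M) (by filter_upwards [h] with t ht; exact max_eq_right ht)
  intro t ht
  have h1 : max (f t) M = M := key ht
  exact (le_max_left _ _).trans h1.le

omit [DecidableEq d] in
/-- `L²` bound from a bound on the finite Fourier sums (Parseval). [folklore] -/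
private theorem integral_sq_le_of_forall_sum_sq_le {f : UnitAddTorus d → ℝ} (hf : MemLp f 2 volume)
    {c : (d → ℤ) → ℂ} (hc : ∀ k, mFourierCoeff (fun x => ((f x : ℝ) : ℂ)) k = c k) {E : ℝ}
    (hE : ∀ F : Finset (d → ℤ), ∑ k ∈ F, ‖c k‖ ^ 2 ≤ E) : ∫ x, f x ^ 2 ≤ E := by
  have hP := hasSum_sq_norm_mFourierCoeff_ofReal hf
  simp_rw [hc] at hP
  rw [← hP.tsum_eq]
  exact hP.summable.tsum_le_of_sum_le hE

omit [DecidableEq d] in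
/-- **Two integrable real functions with the same pairings against all smooth fields agree a.e.**
(test against the cosine and sine modes: the Fourier coefficients coincide,
`re_mFourierCoeff_ofReal` / `im_mFourierCoeff_ofReal`, and Fourier coefficients determine an
integrable function, Grafakos 2014, Prop. 3.2.4). [cite: Grafakos2014, Prop. 3.2.4] -/
theorem ae_eq_of_forall_integral_mul_smooth_eq {f f' : UnitAddTorus d → ℝ} (hf : Integrable f volume)
    (hf' : Integrable f' volume)
    (h : ∀ g : UnitAddTorus d → ℝ, IsSmooth g → ∫ x, f x * g x = ∫ x, f' x * g x) :
    f =ᵐ[volume] f' := by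
  refine ae_eq_of_forall_mFourierCoeff_ofReal_eq hf hf' fun k => Complex.ext ?_ ?_
  · rw [re_mFourierCoeff_ofReal hf, re_mFourierCoeff_ofReal hf']
    exact h _ (isSmooth_reTrigPoly _ _)
  · rw [im_mFourierCoeff_ofReal hf, im_mFourierCoeff_ofReal hf']
    exact h _ (isSmooth_reTrigPoly _ _)

end Tools

namespace IsWeakScalarTransportDiagForcedOn

variable {T κ : ℝ} {a : d → ℝ} {u : ℝ → UnitAddTorus d → EuclideanSpace ℝ d}
  {s : ℝ → UnitAddTorus d → ℝ} {θ₀ : UnitAddTorus d → ℝ} {θ : ℝ → UnitAddTorus d → ℝ}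

/-! ## The pairing primitive `P_g` -/

/-- The absolutely continuous representative
`P_g(t) = ∫ θ₀ g + ∫_{(0,t]} (∫ θ(τ) (⟪u(τ), ∇g⟫ + κ ∑ᵢ aᵢ ∂ᵢ∂ᵢ g) + ∫ s(τ) g) dτ` of the pairing of
a weak solution with a steady smooth field (`ae_integral_mul_eq`) is continuous on `[0,T]` (the
primitive of a function integrable on `(0,T)`). [cite: DiPernaLions1989, §II.1 (13)–(14)] -/
theorem continuousOn_pairingPrimitive (h : IsWeakScalarTransportDiagForcedOn T a κ u s θ₀ θ)
    {g : UnitAddTorus d → ℝ} (hg : IsSmooth g) :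
    ContinuousOn (fun t => (∫ x, θ₀ x * g x) +
      ∫ τ in Ioc 0 t, ((∫ x, θ τ x * (⟪u τ x, gradient g x⟫_ℝ +
        κ * ∑ i, a i * FunctionSpaces.Torus.partialDeriv i (FunctionSpaces.Torus.partialDeriv i g) x)) + ∫ x, s τ x * g x)) (Icc 0 T) := by
  have hF0 : IntegrableOn (fun τ => (∫ x, θ τ x * (⟪u τ x, gradient g x⟫_ℝ +
      κ * ∑ i, a i * FunctionSpaces.Torus.partialDeriv i (FunctionSpaces.Torus.partialDeriv i g) x)) + ∫ x, s τ x * g x) (Ioo 0 T) volume :=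
    (h.integrable_mul_steadyFlux hg).integral_prod_left.add
      (h.integrable_source_mul_continuous hg.continuous).integral_prod_left
  have hF : IntegrableOn (fun τ => (∫ x, θ τ x * (⟪u τ x, gradient g x⟫_ℝ +
      κ * ∑ i, a i * FunctionSpaces.Torus.partialDeriv i (FunctionSpaces.Torus.partialDeriv i g) x)) + ∫ x, s τ x * g x) (Icc 0 T) volume :=
    hF0.congr_set_ae Ioo_ae_eq_Icc.symm
  exact continuousOn_const.add (intervalIntegral.continuousOn_primitive hF)

/-! ## The weakly continuous representative and the trace identities -/

/-- **The `C([0,T]; L²_w)` representative of a weak diagonal-diffusion passive scalar with a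
source, and its traces.** For `T > 0` and a weak solution `θ` on `T^d × [0,T)` there is a real
field `w`, jointly measurable on `(0,∞) × T^d` through its space–time lift, with: `w(t) ∈ L²` and
`∫ w(t)² ≤ C` for every `t ≥ 0` (`C` the class's `L^∞_t L²_x` bound); `w(t) = θ(t)` a.e. for
a.e. `t ∈ (0,T)`; `t ↦ ∫ w(t) g` continuous on `[0,T]` for every `g ∈ L²(T^d)`; and the **trace
identities** `∫ w(σ) g = ∫ θ₀ g + ∫_{(0,σ]} (∫ θ (⟪u, ∇g⟫ + κ ∑ᵢ aᵢ ∂ᵢ∂ᵢ g) + ∫ s g)` for every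
smooth `g` and EVERY `σ ∈ [0,T]`. Construction: continuous Fourier coefficient family from the
absolutely continuous representatives of the cosine / sine pairings (`ae_integral_mul_eq`;
DiPerna–Lions 1989, (14)), finite Bessel sums and reality for every `t` by continuity, the
parametrised Riesz–Fischer theorem (`exists_realScalarField_forall_mFourierCoeff_eq`), weak
continuity from the uniform `L²` bound (De Lellis–Székelyhidi 2010, Lemma 7.1 / Appendix A), and
the trace identities for general smooth `g` by continuity of both sides on `[0,T]` and a.e.
agreement. (Beyond `T` the field is the clamped one, `w(t) = w(T)`.) [cite: DeLellisSzekelyhidi2010, Lemma 7.1] -/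
theorem exists_weaklyContinuous_representative [Nonempty d] (hT : 0 < T)
    (h : IsWeakScalarTransportDiagForcedOn T a κ u s θ₀ θ) :
    ∃ w : ℝ → UnitAddTorus d → ℝ,
      AEStronglyMeasurable (stLift w) (volume.restrict (Ioi 0 ×ˢ univ)) ∧
      (∀ t, 0 ≤ t → MemLp (w t) 2 volume) ∧
      (∃ C : ℝ≥0, ∀ t, 0 ≤ t → ∫ x, w t x ^ 2 ≤ C) ∧
      (∀ᵐ t ∂(volume.restrict (Ioo 0 T)), w t =ᵐ[volume] θ t) ∧
      (∀ g : UnitAddTorus d → ℝ, MemLp g 2 volume →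
        ContinuousOn (fun t => ∫ x, w t x * g x) (Icc 0 T)) ∧
      (∀ g : UnitAddTorus d → ℝ, IsSmooth g → ∀ σ ∈ Icc 0 T,
        ∫ x, w σ x * g x = (∫ x, θ₀ x * g x) +
          ∫ τ in Ioc 0 σ, ((∫ x, θ τ x * (⟪u τ x, gradient g x⟫_ℝ +
            κ * ∑ i, a i * FunctionSpaces.Torus.partialDeriv i (FunctionSpaces.Torus.partialDeriv i g) x)) + ∫ x, s τ x * g x)) := by
  -- the primitive predicted by the equation for the pairing with a steady smooth field
  set P : (UnitAddTorus d → ℝ) → ℝ → ℝ := fun g t => (∫ x, θ₀ x * g x) +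
      ∫ τ in Ioc 0 t, ((∫ x, θ τ x * (⟪u τ x, gradient g x⟫_ℝ +
        κ * ∑ i, a i * FunctionSpaces.Torus.partialDeriv i (FunctionSpaces.Torus.partialDeriv i g) x)) + ∫ x, s τ x * g x) with hP
  have hPc : ∀ {g : UnitAddTorus d → ℝ}, IsSmooth g → ContinuousOn (P g) (Icc 0 T) := fun hg => by
    rw [hP]
    exact h.continuousOn_pairingPrimitive hg
  have hPae : ∀ {g : UnitAddTorus d → ℝ}, IsSmooth g →
      ∀ᵐ t ∂(volume.restrict (Ioo 0 T)), ∫ x, θ t x * g x = P g t := fun hg => by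
    rw [hP]
    exact h.ae_integral_mul_eq hg
  -- the class's `L^∞_t L²_x` bound, as a real bound on `∫ θ(t)²`
  obtain ⟨C, hC⟩ := h.ae_lintegral_sq_le
  have hbd : ∀ᵐ t ∂(volume.restrict (Ioo 0 T)), ∫ x, θ t x ^ 2 ≤ (C : ℝ) := by
    filter_upwards [hC, h.ae_memLp_two] with t ht hm
    rw [lintegral_enorm_sq_eq_ofReal_sq hm, ← ENNReal.ofReal_coe_nnreal] at ht
    exact (ENNReal.ofReal_le_ofReal_iff C.coe_nonneg).1 ht
  -- the family on `[0,T]`: real part from the cosine mode, imaginary part from the sine mode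
  set c₀ : ℝ → (d → ℤ) → ℂ := fun t k => ((P (reTrigPoly {-k} fun _ => (1 : ℂ)) t : ℝ) : ℂ) +
      ((P (reTrigPoly {-k} fun _ => -Complex.I) t : ℝ) : ℂ) * Complex.I with hc₀
  clear_value c₀
  have hc₀c : ∀ k, ContinuousOn (fun t => c₀ t k) (Icc 0 T) := fun k => by
    simp only [hc₀]
    exact (Complex.continuous_ofReal.comp_continuousOn (hPc (isSmooth_reTrigPoly _ _))).add
      ((Complex.continuous_ofReal.comp_continuousOn (hPc (isSmooth_reTrigPoly _ _))).mul
        continuousOn_const)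
  -- identification with the Fourier coefficients of the slices, for a.e. `t ∈ (0,T)`
  have hid : ∀ᵐ t ∂(volume.restrict (Ioo 0 T)), ∀ k,
      c₀ t k = mFourierCoeff (fun x => ((θ t x : ℝ) : ℂ)) k := by
    have hA : ∀ᵐ t ∂(volume.restrict (Ioo 0 T)), ∀ k : d → ℤ,
        ∫ x, θ t x * reTrigPoly {-k} (fun _ => (1 : ℂ)) x = P (reTrigPoly {-k} fun _ => (1 : ℂ)) t :=
      ae_all_iff.2 fun k => hPae (isSmooth_reTrigPoly _ _)
    have hB : ∀ᵐ t ∂(volume.restrict (Ioo 0 T)), ∀ k : d → ℤ,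
        ∫ x, θ t x * reTrigPoly {-k} (fun _ => -Complex.I) x = P (reTrigPoly {-k} fun _ => -Complex.I) t :=
      ae_all_iff.2 fun k => hPae (isSmooth_reTrigPoly _ _)
    filter_upwards [hA, hB, h.ae_memLp_two] with t htA htB htm k
    have hI : Integrable (θ t) volume := htm.integrable one_le_two
    simp only [hc₀]
    rw [← htA k, ← htB k, ← re_mFourierCoeff_ofReal hI k, ← im_mFourierCoeff_ofReal hI k]
    exact Complex.re_add_im _
  -- the finite Bessel sums, for every `t ∈ [0,T]`
  have hsum : ∀ t ∈ Icc 0 T, ∀ F : Finset (d → ℤ), ∑ k ∈ F, ‖c₀ t k‖ ^ 2 ≤ (C : ℝ) := by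
    intro t ht F
    refine le_on_Icc_of_ae_restrict_Ioo hT (f := fun t => ∑ k ∈ F, ‖c₀ t k‖ ^ 2)
      (continuousOn_finsetSum _ fun k _ => ((hc₀c k).norm).pow 2) ?_ t ht
    filter_upwards [hid, h.ae_memLp_two, hbd] with τ hτ hτm hτb
    have e : ∑ k ∈ F, ‖c₀ τ k‖ ^ 2 = ∑ k ∈ F, ‖mFourierCoeff (fun x => ((θ τ x : ℝ) : ℂ)) k‖ ^ 2 :=
      Finset.sum_congr rfl fun k _ => by rw [hτ k]
    show ∑ k ∈ F, ‖c₀ τ k‖ ^ 2 ≤ _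
    rw [e]
    exact (sum_le_hasSum F (fun k _ => sq_nonneg _) (hasSum_sq_norm_mFourierCoeff_ofReal hτm)).trans hτb
  -- the reality condition, for every `t ∈ [0,T]`
  have hsym : ∀ t ∈ Icc 0 T, ∀ k, c₀ t (-k) = conj (c₀ t k) := by
    intro t ht k
    refine eqOn_Icc_of_ae_restrict_Ioo (Y := ℂ) hT (f := fun t => c₀ t (-k))
      (g := fun t => conj (c₀ t k)) (hc₀c (-k))
      (Complex.continuous_conj.comp_continuousOn (hc₀c k)) ?_ ht
    filter_upwards [hid] with τ hτ
    rw [hτ (-k), hτ k]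
    exact isConjSymmScalar_mFourierCoeff (θ τ) k
  -- the family clamped to `[0,T]`, continuous on `[0,∞)`
  have hcl : ∀ t : ℝ, (Set.projIcc 0 T hT.le t : ℝ) ∈ Icc 0 T := fun t => (Set.projIcc 0 T hT.le t).2
  have hcl_eq : ∀ t ∈ Icc 0 T, (Set.projIcc 0 T hT.le t : ℝ) = t := fun t ht => by
    rw [Set.projIcc_of_mem hT.le ht]
  set c : ℝ → (d → ℤ) → ℂ := fun t k => c₀ (Set.projIcc 0 T hT.le t : ℝ) k with hc
  have hcc : ∀ k, ContinuousOn (fun t => c t k) (Ici 0) := fun k =>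
    ((hc₀c k).comp (continuous_subtype_val.comp continuous_projIcc).continuousOn fun t _ => hcl t)
  have hccI : ∀ k, ContinuousOn (fun t => c t k) (Icc 0 T) := fun k => (hcc k).mono Icc_subset_Ici_self
  have hcsum : ∀ t, 0 ≤ t → ∀ F : Finset (d → ℤ), ∑ k ∈ F, ‖c t k‖ ^ 2 ≤ (C : ℝ) :=
    fun t _ F => hsum _ (hcl t) F
  have hcsym : ∀ t, 0 ≤ t → ∀ k, c t (-k) = conj (c t k) := fun t _ k => hsym _ (hcl t) k
  -- the Riesz–Fischer representative
  obtain ⟨w, hwm, hw⟩ := exists_realScalarField_forall_mFourierCoeff_eq hcc hcsum hcsym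
  have hwsq : ∀ t, 0 ≤ t → ∫ x, w t x ^ 2 ≤ (C : ℝ) := fun t ht =>
    integral_sq_le_of_forall_sum_sq_le (hw t ht).1 (hw t ht).2 (hcsum t ht)
  -- a.e. identification with `θ`
  have hae : ∀ᵐ t ∂(volume.restrict (Ioo 0 T)), w t =ᵐ[volume] θ t := by
    filter_upwards [hid, h.ae_memLp_two, ae_restrict_mem measurableSet_Ioo] with t ht htm htI
    have ht0 : 0 ≤ t := htI.1.le
    refine ae_eq_of_forall_mFourierCoeff_ofReal_eq ((hw t ht0).1.integrable one_le_two)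
      (htm.integrable one_le_two) fun k => ?_
    rw [(hw t ht0).2 k, hc]
    show c₀ (Set.projIcc 0 T hT.le t : ℝ) k = _
    rw [hcl_eq t (Ioo_subset_Icc_self htI)]
    exact ht k
  -- weak continuity on `[0,T]`
  have hwc : ∀ g : UnitAddTorus d → ℝ, MemLp g 2 volume →
      ContinuousOn (fun t => ∫ x, w t x * g x) (Icc 0 T) := fun g hg =>
    continuousOn_integral_mul_of_coeff (S := Icc 0 T) (c := c) hccI (fun t ht => (hw t ht.1).1)
      (fun t ht k => (hw t ht.1).2 k) (fun t ht => hwsq t ht.1) hg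
  refine ⟨w, hwm, fun t ht => (hw t ht).1, ⟨C, hwsq⟩, hae, hwc, fun g hg σ hσ => ?_⟩
  -- the trace identities: both sides continuous on `[0,T]`, equal a.e.
  have hEq : EqOn (fun t => ∫ x, w t x * g x) (P g) (Icc 0 T) := by
    refine eqOn_Icc_of_ae_restrict_Ioo (Y := ℝ) hT (hwc g (hg.memLp 2)) (hPc hg) ?_
    filter_upwards [hae, hPae hg] with t ht htP
    rw [← htP]
    exact integral_congr_ae (ht.mono fun x hx => by simp only [hx])
  have key := hEq hσ
  simp only [hP] at key
  exact key

/-- **Uniqueness of the trace**: two integrable data satisfying the trace identities of a weak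
solution at the same time `σ` agree a.e. [cite: DiPernaLions1989, §II.1 (13)–(14)] -/
theorem trace_unique (_h : IsWeakScalarTransportDiagForcedOn T a κ u s θ₀ θ) {σ : ℝ}
    {θσ θσ' : UnitAddTorus d → ℝ} (hθσ : Integrable θσ volume) (hθσ' : Integrable θσ' volume)
    (htr : ∀ g : UnitAddTorus d → ℝ, IsSmooth g →
      ∫ x, θσ x * g x = (∫ x, θ₀ x * g x) +
        ∫ τ in Ioc 0 σ, ((∫ x, θ τ x * (⟪u τ x, gradient g x⟫_ℝ +
          κ * ∑ i, a i * FunctionSpaces.Torus.partialDeriv i (FunctionSpaces.Torus.partialDeriv i g) x)) + ∫ x, s τ x * g x))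
    (htr' : ∀ g : UnitAddTorus d → ℝ, IsSmooth g →
      ∫ x, θσ' x * g x = (∫ x, θ₀ x * g x) +
        ∫ τ in Ioc 0 σ, ((∫ x, θ τ x * (⟪u τ x, gradient g x⟫_ℝ +
          κ * ∑ i, a i * FunctionSpaces.Torus.partialDeriv i (FunctionSpaces.Torus.partialDeriv i g) x)) + ∫ x, s τ x * g x)) :
    θσ =ᵐ[volume] θσ' :=
  ae_eq_of_forall_integral_mul_smooth_eq hθσ hθσ' fun g hg => by rw [htr g hg, htr' g hg]

/-- **The trace at `t = 0` is the datum**: an integrable datum `θ₀` satisfies the trace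
identities at `σ = 0` (the time integral over `(0,0]` vanishes), so any integrable field with the
trace identities at `0` — e.g. the slice `w(0)` of the weakly continuous representative — equals
`θ₀` a.e. [cite: DiPernaLions1989, §II.1 (13)–(14)] -/
theorem trace_zero_ae_eq (_h : IsWeakScalarTransportDiagForcedOn T a κ u s θ₀ θ)
    (hθ₀ : Integrable θ₀ volume) {w₀ : UnitAddTorus d → ℝ} (hw₀ : Integrable w₀ volume)
    (htr : ∀ g : UnitAddTorus d → ℝ, IsSmooth g →
      ∫ x, w₀ x * g x = (∫ x, θ₀ x * g x) +
        ∫ τ in Ioc 0 (0 : ℝ), ((∫ x, θ τ x * (⟪u τ x, gradient g x⟫_ℝ +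
          κ * ∑ i, a i * FunctionSpaces.Torus.partialDeriv i (FunctionSpaces.Torus.partialDeriv i g) x)) + ∫ x, s τ x * g x)) :
    w₀ =ᵐ[volume] θ₀ :=
  ae_eq_of_forall_integral_mul_smooth_eq hw₀ hθ₀ fun g hg => by
    rw [htr g hg]
    simp only [Ioc_self, Measure.restrict_empty, integral_zero_measure, add_zero]

end IsWeakScalarTransportDiagForcedOn

end Torus

end Literature.Analysis.FluidPDE

end
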